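import Literature.Geometry.Riemannian.WassersteinW1OptimalCoupling
import HarnessLib

/-!
# Weak lower semicontinuity of the `W₁`-distance (Bamler 2023, §2.2/§2.4; Villani 2003,
# §7.1)

R. Bamler, *Compactness theory of the space of super Ricci flows*, Invent. Math. 233 (2023), §2.4:
weak limits of (almost optimal) couplings are couplings of the limits, with cost not larger than
the limit of the costs — the mechanism of the proofs of the Lemma on almost isometric couplings
and of the Theorem that `(𝕄, d_{GW_p})` is complete (*"so `(φᵢ)_* μᵢ → μ'_∞ ∈ 𝒫(Z)` in `W_p` …
`d_{GW_p}((Xᵢ, dᵢ, μᵢ), (X_∞, d_∞, μ_∞)) ≤ d^Z_{W_p}((φᵢ)_* μᵢ, μ_∞)`"*). We record it for the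
tree's `wassersteinW1` as the sequential weak lower semicontinuity
`d_{W₁}(μ, ν) ≤ liminf_k d_{W₁}(μ_k, ν_k)` for `μ_k → μ`, `ν_k → ν` weakly, on a complete
separable metric space (optimal couplings exist, are tight by Prokhorov's converse, subconverge
weakly by Prokhorov, and the cost is weakly lower semicontinuous —
`WassersteinW1OptimalCoupling.lean`):

* `IsCoupling.of_tendsto` — weak limits of couplings of `μ_k, ν_k` are couplings of the weak
  limits `μ, ν`;
* `wassersteinW1_le_liminf` — **`d_{W₁}(μ, ν) ≤ liminf_k d_{W₁}(μ_k, ν_k)`**.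

Everything is proved; no definitions, no named facts.

## References

* R. H. Bamler, *Compactness theory of the space of super Ricci flows*, Invent. Math. 233 (2023),
  §2.2, Lemma (basic measure theory) (d); §2.4, proofs of the Lemma and of the Theorem
  (`(𝕄, d_{GW_p})` is complete). [Bamler2023]
* C. Villani, *Topics in Optimal Transportation*, GSM 58 (AMS 2003), Theorem 1.3 and §7.1.
  [Villani2003]
-/

noncomputable section

open Set MeasureTheory Filter Topology
open scoped ENNReal NNReal

namespace Literature.Geometry.Riemannian

variable {X : Type*} [MetricSpace X] [MeasurableSpace X] [BorelSpace X] [SecondCountableTopology X]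

/-- **Weak limits of couplings are couplings of the weak limits** (Bamler 2023, §2.4, proof of
the Lemma: *"`q_k → q_∞` weakly, where `q_∞` is also a coupling between `μ₁, μ₂`"*, here with
moving marginals): if `q_k → q`, `μ_k → μ`, `ν_k → ν` weakly and each `q_k` couples `μ_k, ν_k`,
then `q` couples `μ, ν` — the marginal maps are weakly continuous and limits are unique.
[cite: Bamler2023, §2.4, proof of the Lemma (weak limits of couplings)] -/
theorem IsCoupling.of_tendsto {qs : ℕ → ProbabilityMeasure (X × X)}
    {q : ProbabilityMeasure (X × X)} {μs νs : ℕ → ProbabilityMeasure X}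
    {μ ν : ProbabilityMeasure X} (hq : Tendsto qs atTop (𝓝 q)) (hμ : Tendsto μs atTop (𝓝 μ))
    (hν : Tendsto νs atTop (𝓝 ν))
    (h : ∀ k, IsCoupling (μs k : Measure X) (νs k : Measure X) (qs k : Measure (X × X))) :
    IsCoupling (μ : Measure X) (ν : Measure X) (q : Measure (X × X)) := by
  refine ⟨inferInstance, ?_, ?_⟩
  · have h1 : Tendsto (fun k ↦ (qs k).map continuous_fst.measurable.aemeasurable) atTop
        (𝓝 (q.map continuous_fst.measurable.aemeasurable)) :=
      ((ProbabilityMeasure.continuous_map continuous_fst).tendsto q).comp hq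
    have h2 : (fun k ↦ (qs k).map continuous_fst.measurable.aemeasurable) = μs := by
      funext k
      apply ProbabilityMeasure.toMeasure_injective
      rw [ProbabilityMeasure.toMeasure_map]
      exact (h k).2.1
    rw [h2] at h1
    rw [← tendsto_nhds_unique h1 hμ, ProbabilityMeasure.toMeasure_map]
    rfl
  · have h1 : Tendsto (fun k ↦ (qs k).map continuous_snd.measurable.aemeasurable) atTop
        (𝓝 (q.map continuous_snd.measurable.aemeasurable)) :=
      ((ProbabilityMeasure.continuous_map continuous_snd).tendsto q).comp hq
    have h2 : (fun k ↦ (qs k).map continuous_snd.measurable.aemeasurable) = νs := by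
      funext k
      apply ProbabilityMeasure.toMeasure_injective
      rw [ProbabilityMeasure.toMeasure_map]
      exact (h k).2.2
    rw [h2] at h1
    rw [← tendsto_nhds_unique h1 hν, ProbabilityMeasure.toMeasure_map]
    rfl

variable [CompleteSpace X]

/-- **The `W₁`-distance is weakly lower semicontinuous** (the limiting step of Bamler 2023,
§2.4, proofs of the Lemma and of the Theorem (`𝕄` complete); Villani 2003, §7.1): on a complete
separable metric space, if `μ_k → μ` and `ν_k → ν` weakly then
`d_{W₁}(μ, ν) ≤ liminf_k d_{W₁}(μ_k, ν_k)`. Proof: if `d_{W₁}(μ_k, ν_k) < b` along a subsequence,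
optimal couplings `q_k` (`exists_isCoupling_lintegral_edist_eq_wassersteinW1`) form a tight family
(their marginals range in the compact sets `{μ_k} ∪ {μ}`, `{ν_k} ∪ {ν}`; Prokhorov's converse),
hence subconverge weakly (Prokhorov) to a coupling `q` of `μ, ν` (`IsCoupling.of_tendsto`) with
`∫ d dq ≤ b` (`lowerSemicontinuous_lintegral_edist`), so `d_{W₁}(μ, ν) ≤ b`.
[cite: Bamler2023, §2.4, proof of the Theorem ((𝕄, d_{GW_p}) is complete)]
[cite: Villani2003, §7.1] -/
theorem wassersteinW1_le_liminf {μs νs : ℕ → ProbabilityMeasure X} {μ ν : ProbabilityMeasure X}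
    (hμ : Tendsto μs atTop (𝓝 μ)) (hν : Tendsto νs atTop (𝓝 ν)) :
    wassersteinW1 (μ : Measure X) (ν : Measure X) ≤
      liminf (fun k ↦ wassersteinW1 (μs k : Measure X) (νs k : Measure X)) atTop := by
  refine le_of_forall_lt_imp_le_of_dense fun b hb ↦ le_liminf_of_le (h := ?_)
  by_contra hne
  obtain ⟨φ, hφ, hlt⟩ := extraction_of_frequently_atTop (not_eventually.1 hne)
  simp only [not_le] at hlt
  -- optimal couplings along the subsequence
  choose q hq hqcost using fun k ↦
    exists_isCoupling_lintegral_edist_eq_wassersteinW1 (μs (φ k) : Measure X) (νs (φ k) : Measure X)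
  set Q : ℕ → ProbabilityMeasure (X × X) := fun k ↦ ⟨q k, (hq k).1⟩ with hQ_def
  have hQc : ∀ k, (Q k : Measure (X × X)) = q k := fun k ↦ rfl
  -- tightness of the couplings: their marginals range in compact sets
  have htight : IsTightMeasureSet {p : Measure (X × X) | ∃ k, p = q k} := by
    have hm : ∀ {ρs : ℕ → ProbabilityMeasure X} {ρ : ProbabilityMeasure X},
        Tendsto ρs atTop (𝓝 ρ) →
        IsTightMeasureSet {((ρ' : ProbabilityMeasure X) : Measure X) | ρ' ∈ insert ρ (range ρs)} :=
      fun {ρs ρ} hρ ↦ isTightMeasureSet_of_isCompact_closure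
        (by rw [hρ.isCompact_insert_range.isClosed.closure_eq]; exact hρ.isCompact_insert_range)
    refine IsTightMeasureSet.prodMk ((hm hμ).subset ?_) ((hm hν).subset ?_)
    · rintro _ ⟨_, ⟨k, rfl⟩, rfl⟩
      exact ⟨μs (φ k), mem_insert_of_mem _ (mem_range_self _), (hq k).2.1.symm⟩
    · rintro _ ⟨_, ⟨k, rfl⟩, rfl⟩
      exact ⟨νs (φ k), mem_insert_of_mem _ (mem_range_self _), (hq k).2.2.symm⟩
  have hcomp : IsCompact (closure (range Q)) := by
    refine isCompact_closure_of_isTightMeasureSet (htight.subset ?_)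
    rintro _ ⟨_, ⟨k, rfl⟩, rfl⟩
    exact ⟨k, rfl⟩
  -- a weakly convergent subsequence and its limit coupling
  obtain ⟨Qlim, -, ψ, hψ, hlim⟩ :=
    hcomp.tendsto_subseq (x := Q) fun k ↦ subset_closure (mem_range_self k)
  have hcoup : IsCoupling (μ : Measure X) (ν : Measure X) (Qlim : Measure (X × X)) :=
    IsCoupling.of_tendsto hlim (hμ.comp (hφ.comp hψ).tendsto_atTop)
      (hν.comp (hφ.comp hψ).tendsto_atTop) fun k ↦ hq (ψ k)
  -- its cost is at most `b`
  have hcost : ∫⁻ p, edist p.1 p.2 ∂(Qlim : Measure (X × X)) ≤ b := by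
    by_contra hgt
    rw [not_le] at hgt
    obtain ⟨k, hk⟩ := (hlim.eventually (lowerSemicontinuous_lintegral_edist Qlim b hgt)).exists
    simp only [Function.comp_apply, hQc, hqcost] at hk
    exact lt_irrefl _ (hk.trans (hlt (ψ k)))
  exact lt_irrefl _ (hb.trans_le ((wassersteinW1_le_lintegral hcoup).trans hcost))

end Literature.Geometry.Riemannian

end
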